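import Summits.QuantumFields.YangMills.Theorems.LuscherReductionTwistedTraceScalingInnerTwoZoneBudget
import Summits.QuantumFields.YangMills.Theorems.TwistedTraceScaling.Negative.SmearingWindowCost
import HarnessLib

/-!
# R50T (crux `TwistedTraceScaling`, stmt-QuantumFields-20203; TIGHTNESS companion of R50 `…Negative.SmearingWindowCost`): the band of admissible window radii for the
# (C1a) smearing amplitude is `β^{-q}·polylog`, `q > 1/6` — R50 kills `q = s/2 < 1/6` (`δu = β^{-s/2}`, `σ = β^{-s}`), and here the REPAIRED windows
# `δu = 5MK·powScale s β`, `σ = 12L³(5MK·powScale s β)⁴` (the minimal ones compatible with `hχlo` of `central_transfer_two_sided_chart`, landed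
# `…BOCentralTransfer` 2026-08-29T05:22Z) put BOTH first-order floors of R50 inside the OFF-DIAG budget for every `s > 1/6`, polylogarithmic scale factors included

Standing disprover `ym-cdisprove-20203-1` (gen 41).  R50 (`coreEta_ge_window`, `coreEta_ge_sqrtAction`, `smearing_offDiag_budget_false_of_window/_of_action`) showed that
on any scale with `βT² ≥ 1` the smearing exponent `η₀ ⊇ coreEta L β 0 δu T R Γ σ` has the floors `192|E|·βT²·δu` and `1728N_P·βT²·√σ`, first order in the window radii, so
`δu = β^{-s/2}` or `σ = β^{-s}` (`s < 1/3`) violates `b² ≤ εθλ_b(L³β)/16` via R21.  This file certifies the other side of the band (numbers, not adjectives):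
* `logpow_mul_powScale_le` — polylog absorption: `A(log β)^m·powScale s β ≤ (A/((s−s′)/(m+1))^m)·powScale s′ β` for `β ≥ 1`, `s′ < s`, `A ≥ 0`
  (`log β ≤ β^ε/ε`, `ε = (s−s′)/(m+1)`);
* ★ `polylog_window_affordable` — for `s > 1/6`, every `A ≥ 0`, `m`, `ε, θ > 0`: eventually some `b ≥ A(log β)^m·powScale s β` has `b² ≤ εθλ_b(L³β)/16`
  (lane A's `offDiag_budget_of_core` at `s′ = (s + 1/6)/2`);
* ★★ `window_floor_affordable` — on lane A's scale `βT(β)² ≤ 225L²(log β)⁴` (`T = T_W ≈ 15Lβ^{-1/2}ℓ²`, `ℓ = log β`) the REPAIRED input window `δu = 5MK·powScale s β`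
  makes R50's window floor `192|E|·β·δu·T²` affordable for every `s > 1/6`;
* ★★ `action_floor_affordable` — the REPAIRED action window `σ = 12L³(5MK·powScale s β)⁴` (`√σ = √(12L³)·(5MK)²·powScale (2s) β`) makes R50's action floor
  `1728N_P·β·T²·√σ` affordable for every `s > 1/12` (a fortiori on the C4-CORE window).
READING.  Together with R50: the smearing windows must and can be chosen in the band `[5MKβ^{-s}, o(β^{-1/6}))` (input) / `√σ ∈ [O(β^{-2s}), o(β^{-1/6}))` (action),
non-empty iff `s > 1/6`; the polylogarithmic scale `βT_W² = O(L²ℓ⁴)` costs nothing in the exponent.  The remaining terms of `η₀` are not priced here (lane A's RATES files).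
HONEST FRAMING: exponent bookkeeping about hypotheses of bricks of a stub of a child of the CONDITIONAL reduction route R2b1; positive statements here concern two summands of
`coreEta` only, not (C1)'s full `η_c`; (C1) rates, (C4), (C5), (B-ST), C4-CORE OPEN; not infinite volume, not a gap, not Clay.
-/

set_option autoImplicit false

noncomputable section

open Real
open Literature.MathematicalPhysics.QuantumFieldTheory
open Literature.MathematicalPhysics.QuantumLattice
open Summit.QuantumFields.YangMills.Theorems.FemtoTransferGap
open Summit.QuantumFields.YangMills.Theorems.FemtoTransferGap.TwoLattice

namespace Summit.QuantumFields.YangMills.Theorems.TwistedTraceScaling.Negative.R50T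

variable {L : ℕ} [NeZero L]

/-! ## §1 Polylog absorption -/

/-- `A·(log β)^m·powScale s β ≤ (A/ε^m)·powScale s′ β` for `β ≥ 1`, `s′ < s`, `A ≥ 0`, with `ε = (s − s′)/(m+1)` (`log β ≤ β^ε/ε`). [folklore] -/
theorem logpow_mul_powScale_le {s s' A : ℝ} (m : ℕ) (hs : s' < s) (hA : 0 ≤ A) {β : ℝ} (hβ : 1 ≤ β) :
    A * Real.log β ^ m * powScale s β ≤ A / ((s - s') / (m + 1)) ^ m * powScale s' β := by
  have hβ0 : 0 < β := by linarith
  have hε : 0 < (s - s') / (m + 1) := div_pos (by linarith) (by positivity)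
  have hlog0 : 0 ≤ Real.log β := Real.log_nonneg hβ
  have hlog : Real.log β ≤ β ^ ((s - s') / (m + 1)) / ((s - s') / (m + 1)) := Real.log_le_rpow_div hβ0.le hε
  have hpow : Real.log β ^ m ≤ (β ^ ((s - s') / (m + 1)) / ((s - s') / (m + 1))) ^ m := pow_le_pow_left₀ hlog0 hlog m
  have hexp : (β ^ ((s - s') / (m + 1))) ^ m = β ^ ((s - s') / (m + 1) * m) := by
    rw [← Real.rpow_natCast, ← Real.rpow_mul hβ0.le]
  rw [div_pow, hexp] at hpow
  rw [powScale_eq hβ, powScale_eq hβ]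
  have hs0 : 0 < β ^ (-s) := Real.rpow_pos_of_pos hβ0 _
  -- β^{(s−s′)m/(m+1)} · β^{−s} ≤ β^{−s′}
  have hmono : β ^ ((s - s') / (m + 1) * m) * β ^ (-s) ≤ β ^ (-s') := by
    rw [← Real.rpow_add hβ0]
    apply Real.rpow_le_rpow_of_exponent_le hβ
    have hm : (m : ℝ) / (m + 1) ≤ 1 := by
      rw [div_le_one (by positivity)]; linarith
    have h1 : (s - s') / (m + 1) * m = (s - s') * ((m : ℝ) / (m + 1)) := by ring
    rw [h1]; nlinarith
  calc A * Real.log β ^ m * β ^ (-s) ≤ A * (β ^ ((s - s') / (m + 1) * m) / ((s - s') / (m + 1)) ^ m) * β ^ (-s) :=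
        mul_le_mul_of_nonneg_right (mul_le_mul_of_nonneg_left hpow hA) hs0.le
    _ = A / ((s - s') / (m + 1)) ^ m * (β ^ ((s - s') / (m + 1) * m) * β ^ (-s)) := by
        field_simp
    _ ≤ A / ((s - s') / (m + 1)) ^ m * β ^ (-s') := mul_le_mul_of_nonneg_left hmono (by positivity)

/-- ★ **POLYLOG WINDOWS ARE AFFORDABLE IFF THE EXPONENT EXCEEDS `1/6`** (positive side; the negative side is R21/R50): for `s > 1/6`, `A ≥ 0`, any `m`, `ε, θ > 0`,
eventually some `b ≥ A(log β)^m·powScale s β` satisfies the OFF-DIAG budget `b² ≤ εθλ_b(L³β)/16`. [cite: Luscher1983, §3] -/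
theorem polylog_window_affordable {s A ε θ : ℝ} (m : ℕ) (hs : 1 / 6 < s) (hA : 0 ≤ A) (hε : 0 < ε) (hθ : 0 < θ) :
    ∃ β0 : ℝ, ∀ β : ℝ, β0 ≤ β → ∃ b : ℝ, A * Real.log β ^ m * powScale s β ≤ b ∧ b ^ 2 ≤ ε * θ * bareLambda ((L : ℝ) ^ 3 * β) / 16 := by
  have hs' : 1 / 6 < (s + 1 / 6) / 2 := by linarith
  have hs'' : (s + 1 / 6) / 2 < s := by linarith
  obtain ⟨β0, h⟩ := offDiag_budget_of_core (L := L) (κ := A / ((s - (s + 1 / 6) / 2) / (m + 1)) ^ m) hs' hε hθ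
  refine ⟨max β0 1, fun β hβ => ?_⟩
  obtain ⟨b, hb, hb2⟩ := h β ((le_max_left _ _).trans hβ)
  exact ⟨b, (logpow_mul_powScale_le m hs'' hA ((le_max_right _ _).trans hβ)).trans hb, hb2⟩

/-! ## §2 The repaired windows on lane A's scale `βT² ≤ 225L²(log β)⁴` -/

/-- ★★ **THE REPAIRED INPUT WINDOW IS AFFORDABLE**: with `δu = 5MK·powScale s β` (`M, K ≥ 0`) and `βT(β)² ≤ 225L²(log β)⁴` for `β ≥ 1`, R50's window floor
`192|E|·β·δu·T²` is eventually below some `b` with `b² ≤ εθλ_b(L³β)/16`, for every `s > 1/6`, `ε, θ > 0`. [cite: Luscher1983, §3] -/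
theorem window_floor_affordable {s M K ε θ : ℝ} (hs : 1 / 6 < s) (hM : 0 ≤ M) (hK : 0 ≤ K) (hε : 0 < ε) (hθ : 0 < θ) {T : ℝ → ℝ}
    (hT : ∀ β : ℝ, 1 ≤ β → β * T β ^ 2 ≤ 225 * (L : ℝ) ^ 2 * Real.log β ^ 4) :
    ∃ β0 : ℝ, ∀ β : ℝ, β0 ≤ β → ∃ b : ℝ,
      192 * (Fintype.card (Edge 3 L) : ℝ) * β * (5 * (M * (K * powScale s β))) * T β ^ 2 ≤ b ∧ b ^ 2 ≤ ε * θ * bareLambda ((L : ℝ) ^ 3 * β) / 16 := by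
  obtain ⟨β0, h⟩ := polylog_window_affordable (L := L) 4 hs
    (A := 192 * (Fintype.card (Edge 3 L) : ℝ) * (225 * (L : ℝ) ^ 2) * (5 * (M * K))) (by positivity) hε hθ
  refine ⟨max β0 1, fun β hβ => ?_⟩
  have hβ1 : 1 ≤ β := (le_max_right _ _).trans hβ
  obtain ⟨b, hb, hb2⟩ := h β ((le_max_left _ _).trans hβ)
  refine ⟨b, le_trans ?_ hb, hb2⟩
  have hps := (powScale_pos s β).le
  have hc : 0 ≤ 192 * (Fintype.card (Edge 3 L) : ℝ) * (5 * (M * (K * powScale s β))) := by positivity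
  calc 192 * (Fintype.card (Edge 3 L) : ℝ) * β * (5 * (M * (K * powScale s β))) * T β ^ 2
      = 192 * (Fintype.card (Edge 3 L) : ℝ) * (5 * (M * (K * powScale s β))) * (β * T β ^ 2) := by ring
    _ ≤ 192 * (Fintype.card (Edge 3 L) : ℝ) * (5 * (M * (K * powScale s β))) * (225 * (L : ℝ) ^ 2 * Real.log β ^ 4) :=
        mul_le_mul_of_nonneg_left (hT β hβ1) hc
    _ = 192 * (Fintype.card (Edge 3 L) : ℝ) * (225 * (L : ℝ) ^ 2) * (5 * (M * K)) * Real.log β ^ 4 * powScale s β := by ring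

omit [NeZero L] in
/-- `√(12L³·(5MK·powScale s β)⁴) = √(12L³)·(5MK)²·powScale (2s) β` (`M, K ≥ 0` not even needed: squares). [folklore] -/
theorem sqrt_repaired_action {s M K : ℝ} (β : ℝ) :
    Real.sqrt (12 * (L : ℝ) ^ 3 * (5 * (M * (K * powScale s β))) ^ 4) = Real.sqrt (12 * (L : ℝ) ^ 3) * (5 * (M * K)) ^ 2 * powScale (2 * s) β := by
  have h12 : (0 : ℝ) ≤ 12 * (L : ℝ) ^ 3 := by positivity
  have hsq : Real.sqrt (12 * (L : ℝ) ^ 3) ^ 2 = 12 * (L : ℝ) ^ 3 := Real.sq_sqrt h12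
  have e : 12 * (L : ℝ) ^ 3 * (5 * (M * (K * powScale s β))) ^ 4 = (Real.sqrt (12 * (L : ℝ) ^ 3) * (5 * (M * (K * powScale s β))) ^ 2) ^ 2 := by
    linear_combination (-((5 * (M * (K * powScale s β))) ^ 4)) * hsq
  rw [e, Real.sqrt_sq (by positivity), ← R21.powScale_sq]; ring

/-- ★★ **THE REPAIRED ACTION WINDOW IS AFFORDABLE**: with `σ = 12L³(5MK·powScale s β)⁴` and `βT(β)² ≤ 225L²(log β)⁴` for `β ≥ 1`, R50's action floor
`1728N_P·β·T²·√σ` is eventually below some `b` with `b² ≤ εθλ_b(L³β)/16`, for every `s > 1/12` (so on the whole C4-CORE window), `ε, θ > 0`. [cite: Luscher1983, §3] -/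
theorem action_floor_affordable {s M K ε θ : ℝ} (hs : 1 / 12 < s) (hε : 0 < ε) (hθ : 0 < θ) {T : ℝ → ℝ}
    (hT : ∀ β : ℝ, 1 ≤ β → β * T β ^ 2 ≤ 225 * (L : ℝ) ^ 2 * Real.log β ^ 4) :
    ∃ β0 : ℝ, ∀ β : ℝ, β0 ≤ β → ∃ b : ℝ,
      1728 * (Fintype.card (Plaquette 3 L) : ℝ) * β * T β ^ 2 * Real.sqrt (12 * (L : ℝ) ^ 3 * (5 * (M * (K * powScale s β))) ^ 4) ≤ b ∧
        b ^ 2 ≤ ε * θ * bareLambda ((L : ℝ) ^ 3 * β) / 16 := by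
  have h2s : 1 / 6 < 2 * s := by linarith
  obtain ⟨β0, h⟩ := polylog_window_affordable (L := L) 4 h2s
    (A := 1728 * (Fintype.card (Plaquette 3 L) : ℝ) * (225 * (L : ℝ) ^ 2) * (Real.sqrt (12 * (L : ℝ) ^ 3) * (5 * (M * K)) ^ 2)) (by positivity) hε hθ
  refine ⟨max β0 1, fun β hβ => ?_⟩
  have hβ1 : 1 ≤ β := (le_max_right _ _).trans hβ
  obtain ⟨b, hb, hb2⟩ := h β ((le_max_left _ _).trans hβ)
  refine ⟨b, le_trans ?_ hb, hb2⟩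
  rw [sqrt_repaired_action]
  have hps := (powScale_pos (2 * s) β).le
  have hc : 0 ≤ 1728 * (Fintype.card (Plaquette 3 L) : ℝ) * (Real.sqrt (12 * (L : ℝ) ^ 3) * (5 * (M * K)) ^ 2 * powScale (2 * s) β) := by positivity
  calc 1728 * (Fintype.card (Plaquette 3 L) : ℝ) * β * T β ^ 2 * (Real.sqrt (12 * (L : ℝ) ^ 3) * (5 * (M * K)) ^ 2 * powScale (2 * s) β)
      = 1728 * (Fintype.card (Plaquette 3 L) : ℝ) * (Real.sqrt (12 * (L : ℝ) ^ 3) * (5 * (M * K)) ^ 2 * powScale (2 * s) β) * (β * T β ^ 2) := by ring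
    _ ≤ 1728 * (Fintype.card (Plaquette 3 L) : ℝ) * (Real.sqrt (12 * (L : ℝ) ^ 3) * (5 * (M * K)) ^ 2 * powScale (2 * s) β) *
          (225 * (L : ℝ) ^ 2 * Real.log β ^ 4) := mul_le_mul_of_nonneg_left (hT β hβ1) hc
    _ = 1728 * (Fintype.card (Plaquette 3 L) : ℝ) * (225 * (L : ℝ) ^ 2) * (Real.sqrt (12 * (L : ℝ) ^ 3) * (5 * (M * K)) ^ 2) *
          Real.log β ^ 4 * powScale (2 * s) β := by ring

/-! ## §3 The band, both sides in one place (R50 negative, R50T positive) -/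

/-- The band of exponents: `s/2 < 1/6 < s` and `1/6 < 2s` on the C4-CORE window `s ∈ (1/6, 1/3)`; lane A's scale `T = 15L(log β)²/√β` meets
`βT² = 225L²(log β)⁴` exactly (so both `1 ≤ βT²` of R50, once `15L(log β)² ≥ 1`, and `βT² ≤ 225L²(log β)⁴` here). [folklore] -/
example {β Lr : ℝ} (hβ : 0 < β) : β * (15 * Lr * Real.log β ^ 2 / Real.sqrt β) ^ 2 = 225 * Lr ^ 2 * Real.log β ^ 4 := by
  have hs : Real.sqrt β ^ 2 = β := Real.sq_sqrt hβ.le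
  rw [div_pow, hs]
  field_simp
  ring

end Summit.QuantumFields.YangMills.Theorems.TwistedTraceScaling.Negative.R50T

end
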